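import Mathlib
import HarnessLib
import Summits.AtomisticToContinuum.FouriersLaw.Theses.JunctionLocality
import Summits.AtomisticToContinuum.FouriersLaw.Theorems.JunctionLocalityDefs
import Summits.AtomisticToContinuum.FouriersLaw.Theorems.JunctionLocalityConductanceLowerBoundStubEscapeFloorAux2
import Summits.AtomisticToContinuum.FouriersLaw.Theorems.BondHeatUncertaintySubdiffusiveBondHeatBathBondReductionDynkin
import Summits.AtomisticToContinuum.FouriersLaw.Theorems.PhononMeanFreePathIncoherentBoundedContactBound

/-!
# Crux `ConductanceLowerBound` (stmt-AtomisticToContinuum-11749), line `kick-dipole-no-collapse`, stub (E) — helper 3: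
# the energy-bookkeeping (dipole) reading of the booked heat dipole

Helper file toward the registered stub `stub_escapeFloor` (E) (lead c1).  For the pinned anharmonic chain
`P = pinnedChain ω₂ lam β γ` (all parameters `> 0`), `T > 0`, `N ≥ 2` and every `t ≥ 0`, the booked dipole
`𝔇_N(t) = bookedDipole P N T t = ∫₀ᵗ 𝒥_N` (`Theorems/JunctionLocalityDefs.lean`) is an EQUAL-TIME relaxation functional
of the contact kick (`helper_kdBookedDipoleLeftReading`):

  `𝔇_N(t) = (γ(N−1)/T²) · ( T² − ⟨k_0, κ_t E_L⟩_{μ_T} − γ ∫₀ᵗ ⟨k_0, κ_s k_0⟩_{μ_T} ds )`,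

`k_0 = p_0² − T` the kinetic excess at the injecting contact, `E_L = H − X/(N−1)` the left-exit-weighted energy
(`X = Σ_x x·e_x` the energy first moment, `energyMoment`), `K_N(s) = ⟨k_0, κ_s k_0⟩_{μ_T}` the boundary kernel of route
`BoundaryEscapeDeficit`, and `T² = ⟨k_0, E_L⟩_{μ_T}` (helper 2).  Ingredients, all landed: the halved kernel
`𝒥_N(s) = (γ/T²)⟨k_0, κ_s J⟩` (helper 1); the generator identity `L E_L = w_L − J/(N−1)`, `w_L = γ(T − p_0²) = −γ k_0`
(`OddSectorIrreversibility.stub_generatorLeftEnergy`); Dynkin's identity for `E_L` under the constructed kernels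
(`…stub_dynkinLeftEnergy`); Dynkin integrated against the `L²` observable `k_0` with Fubini
(`SubdiffusiveBondHeat.pinnedChain_dynkinIntegrated`, Gibbs invariance of the kernels).

Readings.  (i) As `t → ∞`, `⟨k_0, κ_t E_L⟩ → 0` (mixing), so `𝔇_N(∞) = γ(N−1)(1 − (γ/T²)∫₀^∞ K_N)` — verbatim the
normalisation of `BoundaryEscapeDeficit.ResponseIdentity` used by the sibling line `far-contact-fisher-square`; (ii) by
energy conservation `κ_t H − H = ∫₀ᵗ κ_s(w_L + w_R)` the bracket equals `(⟨k_0, κ_t X⟩ + (N−1)γ∫₀ᵗ⟨k_0, κ_s k_{N−1}⟩)/(N−1)`: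
`𝔇_N(t)` is `γ/T²` times the FIRST MOMENT `Σ_x x·Cov(k_0(0), e_x(t))` of the excess-energy profile a time `t` after the
contact kick, plus the far-bath term — the form in which the `N → ∞` locality of (E) is to be read.
-/

noncomputable section

open MeasureTheory ProbabilityTheory Filter Topology Set
open scoped NNReal ENNReal BigOperators
open Literature.MathematicalPhysics.KineticTheory.HeatConduction
open Literature.Barriers.AtomisticToContinuum.OpenChain
open Summit.AtomisticToContinuum.FouriersLaw.Theorems.JunctionLocality
open Summit.AtomisticToContinuum.FouriersLaw.Theorems

namespace Summit.AtomisticToContinuum.FouriersLaw.Cruxes.ConductanceLowerBound.KickDipoleNoCollapse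

variable {N : ℕ}

section Pinned

variable {ω₂ lam β γ : ℝ} (hω : 0 < ω₂) (hl : 0 < lam) (hβ : 0 < β) (hγ : 0 < γ) (hN : 2 ≤ N) {T : ℝ} (hT : 0 < T)
include hω hl hβ hγ hN hT

/-- **Nice-observable facts for `E_L`, `w_L`, `J`** at `ϑ = 1/(4T)`: the left-exit-weighted energy
`E_L = H − X/(N−1)`, the left bath power `w_L` and the total current `J` are continuous and square integrable against
`μ_T`; `w_L` and `J` are integrable against every kernel `κ_s(z, ·)`. -/
theorem leftReading_facts :
    (Continuous fun y : PhaseSpace N => (pinnedChain ω₂ lam β γ).hamiltonian N y - energyMoment (pinnedChain ω₂ lam β γ) N y / ((N : ℝ) - 1)) ∧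
    Integrable (fun y : PhaseSpace N => ((pinnedChain ω₂ lam β γ).hamiltonian N y - energyMoment (pinnedChain ω₂ lam β γ) N y / ((N : ℝ) - 1)) ^ 2)
      ((pinnedChain ω₂ lam β γ).gibbsMeasure N T) ∧
    (Continuous fun y : PhaseSpace N => ∑ i : Fin N, (if i.val = 0 then γ * (T - y.2 i ^ 2) else 0)) ∧
    Integrable (fun y : PhaseSpace N => (∑ i : Fin N, (if i.val = 0 then γ * (T - y.2 i ^ 2) else 0)) ^ 2)
      ((pinnedChain ω₂ lam β γ).gibbsMeasure N T) ∧
    (∀ (s : ℝ) (z : PhaseSpace N), Integrable (fun y : PhaseSpace N => ∑ i : Fin N, (if i.val = 0 then γ * (T - y.2 i ^ 2) else 0))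
      ((pinnedChain ω₂ lam β γ).transitionKernel N T T s.toNNReal z)) ∧
    (∀ (s : ℝ) (z : PhaseSpace N), Integrable (totalCurrentObs (pinnedChain ω₂ lam β γ) N)
      ((pinnedChain ω₂ lam β γ).transitionKernel N T T s.toNNReal z)) := by
  set P := pinnedChain ω₂ lam β γ with hP
  have hN0 : 0 < N := by omega
  obtain ⟨hϑ0, h2ϑ⟩ := LightConeBondHeat.quarter_inv_temp_admissible hT
  have hϑ1 : 1 / (4 * T) < 1 / T := by linarith
  -- E_L
  have heC : Continuous fun y : PhaseSpace N => P.hamiltonian N y - energyMoment P N y / ((N : ℝ) - 1) := by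
    have h1 : Continuous (P.hamiltonian N) := pinnedChain_continuous_hamiltonian ω₂ lam β γ N
    have h2 : Continuous (energyMoment P N) :=
      (OddSectorIrreversibility.contDiff_energyMoment_of_contDiff P (N := N) (pinnedChain_contDiff_U ω₂ lam β γ (n := 0))
        (pinnedChain_contDiff_V ω₂ lam β γ (n := 0))).continuous
    exact h1.sub (h2.div_const _)
  have heb : ∀ y : PhaseSpace N, |P.hamiltonian N y - energyMoment P N y / ((N : ℝ) - 1)| ≤
      1 / (1 / (4 * T)) * Real.exp (1 / (4 * T) * P.hamiltonian N y) := by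
    intro y
    obtain ⟨h0, h1⟩ := OddSectorIrreversibility.pinnedChain_leftEnergy_nonneg_le hω.le hl.le hβ.le γ hN y
    rw [abs_of_nonneg h0]
    refine h1.trans ?_
    have hx : 1 / (4 * T) * P.hamiltonian N y + 1 ≤ Real.exp (1 / (4 * T) * P.hamiltonian N y) := Real.add_one_le_exp _
    rw [div_mul_eq_mul_div, one_mul, le_div_iff₀ hϑ0]
    nlinarith
  obtain ⟨he2, -, -⟩ := SubdiffusiveBondHeat.pinnedChain_integral_sq_act_le hω hl.le hβ hγ hN0 hT hϑ0 h2ϑ heC heb 0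
  -- w_L
  have hwc : Continuous fun y : PhaseSpace N => ∑ i : Fin N, (if i.val = 0 then γ * (T - y.2 i ^ 2) else 0) :=
    OddSectorIrreversibility.continuous_leftBathPower γ T hN0
  have hwb : ∀ y : PhaseSpace N, |∑ i : Fin N, (if i.val = 0 then γ * (T - y.2 i ^ 2) else 0)| ≤
      γ * (2 / (1 / (4 * T)) + T) * Real.exp (1 / (4 * T) * P.hamiltonian N y) :=
    OddSectorIrreversibility.abs_leftBathPower_le_exp hω hl.le hβ.le hγ.le hT.le hN0 hϑ0
  obtain ⟨hw2, -, -⟩ := SubdiffusiveBondHeat.pinnedChain_integral_sq_act_le hω hl.le hβ hγ hN0 hT hϑ0 h2ϑ hwc hwb 0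
  have hwI : ∀ (s : ℝ) (z : PhaseSpace N), Integrable (fun y : PhaseSpace N => ∑ i : Fin N,
      (if i.val = 0 then γ * (T - y.2 i ^ 2) else 0)) (P.transitionKernel N T T s.toNNReal z) := fun s z =>
    SubdiffusiveBondHeat.integrable_of_abs_le_exp
      (SubdiffusiveBondHeat.pinnedChain_integrable_exp_mul_hamiltonian_transitionKernel hω hl.le hT hβ.le hγ.le hN0 hϑ0 hϑ1 _ z)
      hwc hwb
  -- J
  have hJc : Continuous (totalCurrentObs P N) := OddSectorIrreversibility.continuous_totalBondCurrent ω₂ lam β γ N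
  have hJb : ∀ y : PhaseSpace N, |totalCurrentObs P N y| ≤
      N * (N * ((3 + β) / 2) * (2 * Real.exp (1 / (4 * T)) / (1 / (4 * T)) ^ 2)) * Real.exp (1 / (4 * T) * P.hamiltonian N y) :=
    OddSectorIrreversibility.abs_totalBondCurrent_le_exp hω.le hl.le hβ.le γ N hϑ0
  have hJI : ∀ (s : ℝ) (z : PhaseSpace N), Integrable (totalCurrentObs P N) (P.transitionKernel N T T s.toNNReal z) :=
    fun s z => SubdiffusiveBondHeat.integrable_of_abs_le_exp
      (SubdiffusiveBondHeat.pinnedChain_integrable_exp_mul_hamiltonian_transitionKernel hω hl.le hT hβ.le hγ.le hN0 hϑ0 hϑ1 _ z)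
      hJc hJb
  exact ⟨heC, he2, hwc, hw2, hwI, hJI⟩

/-- **Dynkin's identity for `E_L` with the explicit source `w_L − J/(N−1)`** (pointwise, every horizon `r ≥ 0`):
`κ_r E_L(z) − E_L(z) = ∫₀ʳ κ_s(w_L − J/(N−1))(z) ds` (`stub_dynkinLeftEnergy` + `stub_generatorLeftEnergy`). -/
theorem leftEnergy_dynkin_source (r : ℝ≥0) (z : PhaseSpace N) :
    (∫ y, ((pinnedChain ω₂ lam β γ).hamiltonian N y - energyMoment (pinnedChain ω₂ lam β γ) N y / ((N : ℝ) - 1))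
        ∂((pinnedChain ω₂ lam β γ).transitionKernel N T T r z)) -
      ((pinnedChain ω₂ lam β γ).hamiltonian N z - energyMoment (pinnedChain ω₂ lam β γ) N z / ((N : ℝ) - 1)) =
    ∫ s in (0 : ℝ)..(r : ℝ), ∫ y, ((∑ i : Fin N, (if i.val = 0 then γ * (T - y.2 i ^ 2) else 0)) -
        (1 / ((N : ℝ) - 1)) * totalCurrentObs (pinnedChain ω₂ lam β γ) N y)
      ∂((pinnedChain ω₂ lam β γ).transitionKernel N T T s.toNNReal z) := by
  rw [OddSectorIrreversibility.stub_dynkinLeftEnergy ω₂ lam β γ hω hl hβ hγ T hT N hN r z]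
  refine intervalIntegral.integral_congr fun s _ => ?_
  refine integral_congr_ae (Eventually.of_forall fun y => ?_)
  exact OddSectorIrreversibility.stub_generatorLeftEnergy ω₂ lam β γ T N hN y

/-- **The source pairing, split**: for every real `s`,
`∫ k_0 · κ_s(w_L − J/(N−1)) dμ_T = −γ ⟨k_0, κ_s k_0⟩_{μ_T} − (T²/(γ(N−1)))·𝒥_N(s)` (linearity of the kernel integral,
`w_L = −γ k_0`, and the halved kernel `𝒥_N(s) = (γ/T²)⟨k_0, κ_s J⟩` of helper 1). -/
theorem integral_kinExcess_mul_evolve_source (s : ℝ) :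
    ∫ z, (z.2 ⟨0, by omega⟩ ^ 2 - T) * evolve (pinnedChain ω₂ lam β γ) N T
        (fun y => (∑ i : Fin N, (if i.val = 0 then γ * (T - y.2 i ^ 2) else 0)) -
          (1 / ((N : ℝ) - 1)) * totalCurrentObs (pinnedChain ω₂ lam β γ) N y) s z ∂((pinnedChain ω₂ lam β γ).gibbsMeasure N T) =
      -γ * ∫ z, (z.2 ⟨0, by omega⟩ ^ 2 - T) * evolve (pinnedChain ω₂ lam β γ) N T (fun y : PhaseSpace N => y.2 ⟨0, by omega⟩ ^ 2 - T) s z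
          ∂((pinnedChain ω₂ lam β γ).gibbsMeasure N T) -
        T ^ 2 / (γ * ((N : ℝ) - 1)) * kickKernel (pinnedChain ω₂ lam β γ) N T s := by
  set P := pinnedChain ω₂ lam β γ with hP
  have hN0 : 0 < N := by omega
  obtain ⟨-, -, hwc, hw2, hwI, hJI⟩ := leftReading_facts hω hl hβ hγ hN hT
  obtain ⟨hkc, hk2, -⟩ := kinExcess_facts hω hl hβ hγ hN0 hT ⟨0, hN0⟩
  obtain ⟨-, -, -, -, hJ2⟩ := evolve_totalCurrentObs_facts hω hl hβ hγ hN0 hT s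
  have hJm : Measurable (totalCurrentObs P N) := (OddSectorIrreversibility.continuous_totalBondCurrent ω₂ lam β γ N).measurable
  -- pointwise linearity of the kernel integral, and `w_L = -γ k_0`
  have hpt : ∀ z, evolve P N T (fun y => (∑ i : Fin N, (if i.val = 0 then γ * (T - y.2 i ^ 2) else 0)) -
        (1 / ((N : ℝ) - 1)) * totalCurrentObs P N y) s z =
      -γ * evolve P N T (fun y : PhaseSpace N => y.2 ⟨0, hN0⟩ ^ 2 - T) s z -
        (1 / ((N : ℝ) - 1)) * evolve P N T (totalCurrentObs P N) s z := by
    intro z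
    unfold evolve
    have h1 : ∫ y, ((∑ i : Fin N, (if i.val = 0 then γ * (T - y.2 i ^ 2) else 0)) - (1 / ((N : ℝ) - 1)) * totalCurrentObs P N y)
        ∂(P.transitionKernel N T T s.toNNReal z) =
        (∫ y, (∑ i : Fin N, (if i.val = 0 then γ * (T - y.2 i ^ 2) else 0)) ∂(P.transitionKernel N T T s.toNNReal z)) -
          (1 / ((N : ℝ) - 1)) * ∫ y, totalCurrentObs P N y ∂(P.transitionKernel N T T s.toNNReal z) := by
      rw [integral_sub (hwI s z) ((hJI s z).const_mul _), integral_const_mul]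
    have h2 : (∫ y, (∑ i : Fin N, (if i.val = 0 then γ * (T - y.2 i ^ 2) else 0)) ∂(P.transitionKernel N T T s.toNNReal z)) =
        -γ * ∫ y, (y.2 ⟨0, hN0⟩ ^ 2 - T) ∂(P.transitionKernel N T T s.toNNReal z) := by
      rw [← integral_const_mul]
      refine integral_congr_ae (Eventually.of_forall fun y => ?_)
      dsimp only
      rw [OddSectorIrreversibility.leftBathPower_eq γ T hN0 y]
      ring
    rw [h1, h2]
  have hi1 := (abs_pairing_le hω hl hβ hγ hN0 hT hkc.measurable hkc.measurable hk2 hk2 s).1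
  have hi2 := (abs_pairing_le hω hl hβ hγ hN0 hT hkc.measurable hJm hk2 hJ2 s).1
  have he : ∀ z, (z.2 ⟨0, hN0⟩ ^ 2 - T) * evolve P N T (fun y => (∑ i : Fin N, (if i.val = 0 then γ * (T - y.2 i ^ 2) else 0)) -
        (1 / ((N : ℝ) - 1)) * totalCurrentObs P N y) s z =
      -γ * ((z.2 ⟨0, hN0⟩ ^ 2 - T) * evolve P N T (fun y : PhaseSpace N => y.2 ⟨0, hN0⟩ ^ 2 - T) s z) -
        (1 / ((N : ℝ) - 1)) * ((z.2 ⟨0, hN0⟩ ^ 2 - T) * evolve P N T (totalCurrentObs P N) s z) := by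
    intro z; rw [hpt z]; ring
  rw [integral_congr_ae (Eventually.of_forall he), integral_sub (hi1.const_mul _) (hi2.const_mul _), integral_const_mul,
    integral_const_mul]
  have hhalf := helper_kdKickKernelHalving ω₂ lam β γ hω hl hβ hγ T hT N hN0 s
  have hN1 : ((N : ℝ) - 1) ≠ 0 := by
    have : (2 : ℝ) ≤ N := by exact_mod_cast hN
    linarith
  rw [hhalf]
  have hT0 : T ≠ 0 := hT.ne'
  have hγ0 : γ ≠ 0 := hγ.ne'
  field_simp
  ring

end Pinned

/-- **helper (1b) — THE ENERGY-BOOKKEEPING (DIPOLE) READING OF THE BOOKED DIPOLE.**  For the pinned anharmonic chain (all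
parameters `> 0`), `T > 0`, `N ≥ 2` and every `t ≥ 0`:
`bookedDipole P N T t = (γ(N−1)/T²)·(T² − ⟨k_0, κ_t E_L⟩_{μ_T} − γ∫₀ᵗ ⟨k_0, κ_s k_0⟩_{μ_T} ds)` with `k_0 = p_0² − T`,
`E_L = H − X/(N−1)`: the booked heat dipole is an EQUAL-TIME functional — `T² = ⟨k_0, E_L⟩` minus the relaxation of the
left-exit-weighted energy after the contact kick minus the heat already handed back to the injecting bath.  (Dynkin for
`E_L` with source `w_L − J/(N−1)`, integrated against `k_0 ∈ L²(μ_T)` with Fubini, the halved kernel of helper 1, and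
the static pairing of helper 2.) -/
theorem helper_kdBookedDipoleLeftReading : ∀ ω₂ lam β γ : ℝ, 0 < ω₂ → 0 < lam → 0 < β → 0 < γ → ∀ T : ℝ, 0 < T → ∀ (N : ℕ) (hN : 2 ≤ N) (t : ℝ), 0 ≤ t → bookedDipole (pinnedChain ω₂ lam β γ) N T t = γ * ((N : ℝ) - 1) / T ^ 2 * (T ^ 2 - (∫ z, (z.2 ⟨0, by omega⟩ ^ 2 - T) * evolve (pinnedChain ω₂ lam β γ) N T (fun y : PhaseSpace N => (pinnedChain ω₂ lam β γ).hamiltonian N y - energyMoment (pinnedChain ω₂ lam β γ) N y / ((N : ℝ) - 1)) t z ∂((pinnedChain ω₂ lam β γ).gibbsMeasure N T)) - γ * ∫ s in (0 : ℝ)..t, ∫ z, (z.2 ⟨0, by omega⟩ ^ 2 - T) * evolve (pinnedChain ω₂ lam β γ) N T (fun y : PhaseSpace N => y.2 ⟨0, by omega⟩ ^ 2 - T) s z ∂((pinnedChain ω₂ lam β γ).gibbsMeasure N T)) := by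
  intro ω₂ lam β γ hω hl hβ hγ T hT N hN t ht
  set P := pinnedChain ω₂ lam β γ with hP
  have hN0 : 0 < N := by omega
  set μ := P.gibbsMeasure N T with hμ
  haveI : IsProbabilityMeasure μ := pinnedChain_isProbabilityMeasure_gibbsMeasure hω hl.le hβ.le γ N hT
  obtain ⟨heC, he2, hwc, hw2, -, -⟩ := leftReading_facts hω hl hβ hγ hN hT
  obtain ⟨hkc, hk2, -⟩ := kinExcess_facts hω hl hβ hγ hN0 hT ⟨0, hN0⟩
  obtain ⟨-, -, -, -, hJ2⟩ := evolve_totalCurrentObs_facts hω hl hβ hγ hN0 hT 0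
  have hJc : Continuous (totalCurrentObs P N) := OddSectorIrreversibility.continuous_totalBondCurrent ω₂ lam β γ N
  -- the source `ℓ = w_L - J/(N-1)` is continuous and square integrable
  set ℓ : PhaseSpace N → ℝ := fun y => (∑ i : Fin N, (if i.val = 0 then γ * (T - y.2 i ^ 2) else 0)) -
    (1 / ((N : ℝ) - 1)) * totalCurrentObs P N y with hℓ
  have hℓc : Continuous ℓ := hwc.sub (continuous_const.mul hJc)
  have hℓ2 : Integrable (fun y => ℓ y ^ 2) μ := by
    have hdom : Integrable (fun y => 2 * (∑ i : Fin N, (if i.val = 0 then γ * (T - y.2 i ^ 2) else 0)) ^ 2 +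
        2 * ((1 / ((N : ℝ) - 1)) ^ 2 * totalCurrentObs P N y ^ 2)) μ := (hw2.const_mul 2).add ((hJ2.const_mul _).const_mul 2)
    refine hdom.mono' (hℓc.pow 2).aestronglyMeasurable (Eventually.of_forall fun y => ?_)
    rw [Real.norm_eq_abs, abs_of_nonneg (sq_nonneg _), hℓ]
    dsimp only
    nlinarith [sq_nonneg ((∑ i : Fin N, (if i.val = 0 then γ * (T - y.2 i ^ 2) else 0)) + (1 / ((N : ℝ) - 1)) * totalCurrentObs P N y)]
  -- Dynkin integrated against `k_0`
  have hinv : ∀ s : ℝ≥0, μ.bind (P.transitionKernel N T T s) = μ := fun s =>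
    SubdiffusiveBondHeat.pinnedChain_gibbsMeasure_bind_transitionKernel hω hl.le hβ.le hγ.le hN0 hT s
  have hdyn := SubdiffusiveBondHeat.pinnedChain_dynkinIntegrated ω₂ lam β γ hω hl.le hβ.le hγ.le N T T μ hinv
    (fun z : PhaseSpace N => z.2 ⟨0, hN0⟩ ^ 2 - T)
    (fun y : PhaseSpace N => P.hamiltonian N y - energyMoment P N y / ((N : ℝ) - 1)) ℓ
    hkc.measurable heC.measurable hℓc.measurable hk2 he2 hℓ2
    (fun r z => leftEnergy_dynkin_source hω hl hβ hγ hN hT r z) t ht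
  -- the right-hand side: split in `s`
  have hsrc : ∀ s : ℝ, ∫ z, (z.2 ⟨0, hN0⟩ ^ 2 - T) * (∫ y, ℓ y ∂(P.transitionKernel N T T s.toNNReal z)) ∂μ =
      -γ * ∫ z, (z.2 ⟨0, hN0⟩ ^ 2 - T) * evolve P N T (fun y : PhaseSpace N => y.2 ⟨0, hN0⟩ ^ 2 - T) s z ∂μ -
        T ^ 2 / (γ * ((N : ℝ) - 1)) * kickKernel P N T s :=
    fun s => integral_kinExcess_mul_evolve_source hω hl hβ hγ hN hT s
  have hKc : Continuous fun s : ℝ => ∫ z, (z.2 ⟨0, hN0⟩ ^ 2 - T) *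
      evolve P N T (fun y : PhaseSpace N => y.2 ⟨0, hN0⟩ ^ 2 - T) s z ∂μ :=
    SubdiffusiveBondHeat.pinnedChain_continuous_kinCorr hω hl.le hβ hγ hN0 hT
  obtain ⟨-, -, hkickI⟩ := helper_kdKickKernelBounded ω₂ lam β γ hω hl hβ hγ T hT N hN0
  have hrhs : ∫ s in (0 : ℝ)..t, ∫ z, (z.2 ⟨0, hN0⟩ ^ 2 - T) * (∫ y, ℓ y ∂(P.transitionKernel N T T s.toNNReal z)) ∂μ =
      -γ * (∫ s in (0 : ℝ)..t, ∫ z, (z.2 ⟨0, hN0⟩ ^ 2 - T) *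
          evolve P N T (fun y : PhaseSpace N => y.2 ⟨0, hN0⟩ ^ 2 - T) s z ∂μ) -
        T ^ 2 / (γ * ((N : ℝ) - 1)) * bookedDipole P N T t := by
    rw [intervalIntegral.integral_congr (fun s _ => hsrc s), intervalIntegral.integral_sub ((hKc.intervalIntegrable 0 t).const_mul _)
      ((hkickI 0 t).const_mul _), intervalIntegral.integral_const_mul, intervalIntegral.integral_const_mul, bookedDipole_def]
  -- the static pairing
  have hstat : ∫ z, (z.2 ⟨0, hN0⟩ ^ 2 - T) * (P.hamiltonian N z - energyMoment P N z / ((N : ℝ) - 1)) ∂μ = T ^ 2 :=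
    helper_kdContactPairingLeftEnergy ω₂ lam β γ hω hl hβ hγ T hT N hN
  rw [hrhs, hstat] at hdyn
  have hN1 : ((N : ℝ) - 1) ≠ 0 := by
    have : (2 : ℝ) ≤ N := by exact_mod_cast hN
    linarith
  have hγ0 : γ ≠ 0 := hγ.ne'
  have hT0 : T ≠ 0 := hT.ne'
  -- solve the linear identity for `bookedDipole`
  have key : T ^ 2 / (γ * ((N : ℝ) - 1)) * bookedDipole P N T t =
      T ^ 2 - (∫ z, (z.2 ⟨0, hN0⟩ ^ 2 - T) * evolve P N T (fun y : PhaseSpace N => P.hamiltonian N y - energyMoment P N y / ((N : ℝ) - 1)) t z ∂μ) -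
        γ * ∫ s in (0 : ℝ)..t, ∫ z, (z.2 ⟨0, hN0⟩ ^ 2 - T) * evolve P N T (fun y : PhaseSpace N => y.2 ⟨0, hN0⟩ ^ 2 - T) s z ∂μ := by
    have hdyn' : (∫ z, (z.2 ⟨0, hN0⟩ ^ 2 - T) * evolve P N T (fun y : PhaseSpace N => P.hamiltonian N y - energyMoment P N y / ((N : ℝ) - 1)) t z ∂μ) - T ^ 2 =
        -γ * (∫ s in (0 : ℝ)..t, ∫ z, (z.2 ⟨0, hN0⟩ ^ 2 - T) * evolve P N T (fun y : PhaseSpace N => y.2 ⟨0, hN0⟩ ^ 2 - T) s z ∂μ) -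
          T ^ 2 / (γ * ((N : ℝ) - 1)) * bookedDipole P N T t := hdyn
    linarith
  show bookedDipole P N T t = γ * ((N : ℝ) - 1) / T ^ 2 * (T ^ 2 - (∫ z, (z.2 ⟨0, hN0⟩ ^ 2 - T) *
      evolve P N T (fun y : PhaseSpace N => P.hamiltonian N y - energyMoment P N y / ((N : ℝ) - 1)) t z ∂μ) -
        γ * ∫ s in (0 : ℝ)..t, ∫ z, (z.2 ⟨0, hN0⟩ ^ 2 - T) * evolve P N T (fun y : PhaseSpace N => y.2 ⟨0, hN0⟩ ^ 2 - T) s z ∂μ)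
  rw [← key]
  field_simp


/-! ### The right (first-moment) reading -/

/-- **Interval integrability of an equilibrium pairing** `s ↦ ⟨a, κ_s b⟩_{μ_T}` (continuous `a`, measurable `b`,
`a², b² ∈ L¹(μ_T)`): measurable and bounded in time. -/
theorem intervalIntegrable_pairing {ω₂ lam β γ : ℝ} (hω : 0 < ω₂) (hl : 0 < lam) (hβ : 0 < β) (hγ : 0 < γ)
    (hN : 0 < N) {T : ℝ} (hT : 0 < T) {a b : PhaseSpace N → ℝ} (ha : Continuous a) (hb : Measurable b)
    (ha2 : Integrable (fun z => a z ^ 2) ((pinnedChain ω₂ lam β γ).gibbsMeasure N T))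
    (hb2 : Integrable (fun z => b z ^ 2) ((pinnedChain ω₂ lam β γ).gibbsMeasure N T)) (u v : ℝ) :
    IntervalIntegrable (fun s : ℝ => ∫ z, a z * evolve (pinnedChain ω₂ lam β γ) N T b s z ∂((pinnedChain ω₂ lam β γ).gibbsMeasure N T))
      volume u v := by
  refine (intervalIntegrable_const : IntervalIntegrable (fun _ : ℝ =>
      ((∫ z, a z ^ 2 ∂((pinnedChain ω₂ lam β γ).gibbsMeasure N T)) + ∫ z, b z ^ 2 ∂((pinnedChain ω₂ lam β γ).gibbsMeasure N T)) / 2)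
      volume u v).mono_fun' (measurable_pairing hω hβ hγ hT hl.le ha hb).aestronglyMeasurable (Eventually.of_forall fun s => ?_)
  show ‖∫ z, a z * evolve (pinnedChain ω₂ lam β γ) N T b s z ∂((pinnedChain ω₂ lam β γ).gibbsMeasure N T)‖ ≤ _
  rw [Real.norm_eq_abs]
  exact (abs_pairing_le hω hl hβ hγ hN hT ha.measurable hb ha2 hb2 s).2

/-- **The energy first moment paired with the contact kick splits as `X = (N−1)(H − E_L)`**: for `t : ℝ`,
`⟨k_0, κ_t X⟩_{μ_T} = (N−1)(⟨k_0, κ_t H⟩_{μ_T} − ⟨k_0, κ_t E_L⟩_{μ_T})`. -/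
theorem integral_kinExcess_mul_evolve_energyMoment {ω₂ lam β γ : ℝ} (hω : 0 < ω₂) (hl : 0 < lam) (hβ : 0 < β) (hγ : 0 < γ)
    (hN : 2 ≤ N) {T : ℝ} (hT : 0 < T) (t : ℝ) :
    ∫ z, (z.2 ⟨0, by omega⟩ ^ 2 - T) * evolve (pinnedChain ω₂ lam β γ) N T (energyMoment (pinnedChain ω₂ lam β γ) N) t z
        ∂((pinnedChain ω₂ lam β γ).gibbsMeasure N T) =
      ((N : ℝ) - 1) * ((∫ z, (z.2 ⟨0, by omega⟩ ^ 2 - T) * evolve (pinnedChain ω₂ lam β γ) N T ((pinnedChain ω₂ lam β γ).hamiltonian N) t z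
          ∂((pinnedChain ω₂ lam β γ).gibbsMeasure N T)) -
        ∫ z, (z.2 ⟨0, by omega⟩ ^ 2 - T) * evolve (pinnedChain ω₂ lam β γ) N T
          (fun y : PhaseSpace N => (pinnedChain ω₂ lam β γ).hamiltonian N y - energyMoment (pinnedChain ω₂ lam β γ) N y / ((N : ℝ) - 1)) t z
          ∂((pinnedChain ω₂ lam β γ).gibbsMeasure N T)) := by
  set P := pinnedChain ω₂ lam β γ with hP
  have hN0 : 0 < N := by omega
  have hN1 : ((N : ℝ) - 1) ≠ 0 := by
    have : (2 : ℝ) ≤ N := by exact_mod_cast hN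
    linarith
  obtain ⟨hϑ0, h2ϑ⟩ := LightConeBondHeat.quarter_inv_temp_admissible hT
  have hϑ1 : 1 / (4 * T) < 1 / T := by linarith
  obtain ⟨heC, he2, -, -, -, -⟩ := leftReading_facts hω hl hβ hγ hN hT
  obtain ⟨hkc, hk2, -⟩ := kinExcess_facts hω hl hβ hγ hN0 hT ⟨0, hN0⟩
  have hHc : Continuous (P.hamiltonian N) := pinnedChain_continuous_hamiltonian ω₂ lam β γ N
  have hH0 : ∀ y, 0 ≤ P.hamiltonian N y := fun y => pinnedChain_hamiltonian_nonneg hω.le hl.le hβ.le γ N y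
  have hexpb : ∀ y, P.hamiltonian N y ≤ 1 / (1 / (4 * T)) * Real.exp (1 / (4 * T) * P.hamiltonian N y) := by
    intro y
    have hx : 1 / (4 * T) * P.hamiltonian N y + 1 ≤ Real.exp (1 / (4 * T) * P.hamiltonian N y) := Real.add_one_le_exp _
    rw [div_mul_eq_mul_div, one_mul, le_div_iff₀ hϑ0]
    nlinarith
  have hHb : ∀ y, |P.hamiltonian N y| ≤ 1 / (1 / (4 * T)) * Real.exp (1 / (4 * T) * P.hamiltonian N y) := fun y => by
    rw [abs_of_nonneg (hH0 y)]; exact hexpb y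
  have heb : ∀ y, |P.hamiltonian N y - energyMoment P N y / ((N : ℝ) - 1)| ≤
      1 / (1 / (4 * T)) * Real.exp (1 / (4 * T) * P.hamiltonian N y) := by
    intro y
    obtain ⟨h0, h1⟩ := OddSectorIrreversibility.pinnedChain_leftEnergy_nonneg_le hω.le hl.le hβ.le γ hN y
    rw [abs_of_nonneg h0]
    exact h1.trans (hexpb y)
  have hH2 : Integrable (fun y => P.hamiltonian N y ^ 2) (P.gibbsMeasure N T) :=
    SubdiffusiveBondHeat.pinnedChain_integrable_sq_of_abs_le hω hl.le hβ.le γ N hT hHc (C := 1) fun y => by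
      rw [abs_of_nonneg (hH0 y)]; nlinarith [hH0 y, sq_nonneg (P.hamiltonian N y)]
  -- pointwise: `κ_t X = (N-1)(κ_t H - κ_t E_L)`
  have hpt : ∀ z, evolve P N T (energyMoment P N) t z =
      ((N : ℝ) - 1) * (evolve P N T (P.hamiltonian N) t z -
        evolve P N T (fun y : PhaseSpace N => P.hamiltonian N y - energyMoment P N y / ((N : ℝ) - 1)) t z) := by
    intro z
    have hHI : Integrable (P.hamiltonian N) (P.transitionKernel N T T t.toNNReal z) :=
      SubdiffusiveBondHeat.integrable_of_abs_le_exp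
        (SubdiffusiveBondHeat.pinnedChain_integrable_exp_mul_hamiltonian_transitionKernel hω hl.le hT hβ.le hγ.le hN0 hϑ0 hϑ1 _ z)
        hHc hHb
    have hEI : Integrable (fun y : PhaseSpace N => P.hamiltonian N y - energyMoment P N y / ((N : ℝ) - 1))
        (P.transitionKernel N T T t.toNNReal z) :=
      SubdiffusiveBondHeat.integrable_of_abs_le_exp
        (SubdiffusiveBondHeat.pinnedChain_integrable_exp_mul_hamiltonian_transitionKernel hω hl.le hT hβ.le hγ.le hN0 hϑ0 hϑ1 _ z)
        heC heb
    unfold evolve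
    rw [← integral_sub hHI hEI, ← integral_const_mul]
    refine integral_congr_ae (Eventually.of_forall fun y => ?_)
    field_simp
    ring
  have hi1 := (abs_pairing_le hω hl hβ hγ hN0 hT hkc.measurable hHc.measurable hk2 hH2 t).1
  have hi2 := (abs_pairing_le hω hl hβ hγ hN0 hT hkc.measurable heC.measurable hk2 he2 t).1
  have he : ∀ z, (z.2 ⟨0, hN0⟩ ^ 2 - T) * evolve P N T (energyMoment P N) t z =
      ((N : ℝ) - 1) * ((z.2 ⟨0, hN0⟩ ^ 2 - T) * evolve P N T (P.hamiltonian N) t z) -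
        ((N : ℝ) - 1) * ((z.2 ⟨0, hN0⟩ ^ 2 - T) * evolve P N T (fun y : PhaseSpace N => P.hamiltonian N y - energyMoment P N y / ((N : ℝ) - 1)) t z) := by
    intro z; rw [hpt z]; ring
  rw [integral_congr_ae (Eventually.of_forall he), integral_sub (hi1.const_mul _) (hi2.const_mul _), integral_const_mul,
    integral_const_mul]
  ring

/-- **helper (1b′) — THE FIRST-MOMENT (RIGHT) READING OF THE BOOKED DIPOLE.**  For the pinned anharmonic chain (all
parameters `> 0`), `T > 0`, `N ≥ 2` and every `t ≥ 0`:
`bookedDipole P N T t = (γ/T²)·(⟨k_0, κ_t X⟩_{μ_T} + (N−1)·γ·∫₀ᵗ ⟨k_0, κ_s k_{N−1}⟩_{μ_T} ds)`, `X = Σ_x x·e_x = energyMoment`,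
`k_i = p_i² − T`: since `⟨k_0, X⟩_{μ_T} = 0` and `μ_T(κ_t X) = μ_T(X)`, the booked heat dipole IS `γ/T²` times the FIRST
MOMENT `Σ_x x·Cov_{μ_T}(k_0(0), e_x(t))` of the excess-energy profile a time `t` after the contact kick, plus the
far-bath term (the heat already absorbed at the far contact, booked at `x = N−1`).  From the left reading (helper 1b),
the energy balance `⟨k_0, κ_t H⟩ = T² − γ∫₀ᵗ(⟨k_0,κ_s k_0⟩ + ⟨k_0,κ_s k_{N−1}⟩)`
(`IncoherentBounded.kinObs_hamiltonian_pairing_sub_site`, Dynkin for `H`) and `X = (N−1)(H − E_L)`. -/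
theorem helper_kdBookedDipoleRightReading : ∀ ω₂ lam β γ : ℝ, 0 < ω₂ → 0 < lam → 0 < β → 0 < γ → ∀ T : ℝ, 0 < T → ∀ (N : ℕ) (hN : 2 ≤ N) (t : ℝ), 0 ≤ t → bookedDipole (pinnedChain ω₂ lam β γ) N T t = γ / T ^ 2 * ((∫ z, (z.2 ⟨0, by omega⟩ ^ 2 - T) * evolve (pinnedChain ω₂ lam β γ) N T (energyMoment (pinnedChain ω₂ lam β γ) N) t z ∂((pinnedChain ω₂ lam β γ).gibbsMeasure N T)) + ((N : ℝ) - 1) * γ * ∫ s in (0 : ℝ)..t, ∫ z, (z.2 ⟨0, by omega⟩ ^ 2 - T) * evolve (pinnedChain ω₂ lam β γ) N T (fun y : PhaseSpace N => y.2 ⟨N - 1, by omega⟩ ^ 2 - T) s z ∂((pinnedChain ω₂ lam β γ).gibbsMeasure N T)) := by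
  intro ω₂ lam β γ hω hl hβ hγ T hT N hN t ht
  have hN0 : 0 < N := by omega
  have hN1 : ((N : ℝ) - 1) ≠ 0 := by
    have : (2 : ℝ) ≤ N := by exact_mod_cast hN
    linarith
  have hγ0 : γ ≠ 0 := hγ.ne'
  have hT0 : T ≠ 0 := hT.ne'
  obtain ⟨hkc, hk2, -⟩ := kinExcess_facts hω hl hβ hγ hN0 hT ⟨0, hN0⟩
  obtain ⟨hkLc, hkL2, -⟩ := kinExcess_facts hω hl hβ hγ hN0 hT ⟨N - 1, by omega⟩
  -- the three identities
  have hL := helper_kdBookedDipoleLeftReading ω₂ lam β γ hω hl hβ hγ T hT N hN t ht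
  have hX := integral_kinExcess_mul_evolve_energyMoment hω hl hβ hγ hN hT t
  have hH := IncoherentBounded.kinObs_hamiltonian_pairing_sub_site hω hl.le hβ hγ hN0 hT ⟨0, hN0⟩ t ht
  -- split the time integral of the energy balance
  have hKc : Continuous fun s : ℝ => ∫ z, (z.2 ⟨0, hN0⟩ ^ 2 - T) *
      evolve (pinnedChain ω₂ lam β γ) N T (fun y : PhaseSpace N => y.2 ⟨0, hN0⟩ ^ 2 - T) s z ∂((pinnedChain ω₂ lam β γ).gibbsMeasure N T) :=
    SubdiffusiveBondHeat.pinnedChain_continuous_kinCorr hω hl.le hβ hγ hN0 hT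
  have hCI := intervalIntegrable_pairing hω hl hβ hγ hN0 hT hkc hkLc.measurable hk2 hkL2 0 t
  have hsplit : ∫ s in (0 : ℝ)..t, ((∫ z, (z.2 ⟨0, hN0⟩ ^ 2 - T) * evolve (pinnedChain ω₂ lam β γ) N T (fun y : PhaseSpace N => y.2 ⟨0, hN0⟩ ^ 2 - T) s z
        ∂((pinnedChain ω₂ lam β γ).gibbsMeasure N T)) + ∫ z, (z.2 ⟨0, hN0⟩ ^ 2 - T) * evolve (pinnedChain ω₂ lam β γ) N T (fun y : PhaseSpace N => y.2 ⟨N - 1, by omega⟩ ^ 2 - T) s z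
        ∂((pinnedChain ω₂ lam β γ).gibbsMeasure N T)) =
      (∫ s in (0 : ℝ)..t, ∫ z, (z.2 ⟨0, hN0⟩ ^ 2 - T) * evolve (pinnedChain ω₂ lam β γ) N T (fun y : PhaseSpace N => y.2 ⟨0, hN0⟩ ^ 2 - T) s z
        ∂((pinnedChain ω₂ lam β γ).gibbsMeasure N T)) + ∫ s in (0 : ℝ)..t, ∫ z, (z.2 ⟨0, hN0⟩ ^ 2 - T) *
          evolve (pinnedChain ω₂ lam β γ) N T (fun y : PhaseSpace N => y.2 ⟨N - 1, by omega⟩ ^ 2 - T) s z ∂((pinnedChain ω₂ lam β γ).gibbsMeasure N T) :=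
    intervalIntegral.integral_add (hKc.intervalIntegrable 0 t) hCI
  have hH' : (∫ z, (z.2 ⟨0, hN0⟩ ^ 2 - T) * evolve (pinnedChain ω₂ lam β γ) N T ((pinnedChain ω₂ lam β γ).hamiltonian N) t z ∂((pinnedChain ω₂ lam β γ).gibbsMeasure N T)) - T ^ 2 =
      -γ * ((∫ s in (0 : ℝ)..t, ∫ z, (z.2 ⟨0, hN0⟩ ^ 2 - T) * evolve (pinnedChain ω₂ lam β γ) N T (fun y : PhaseSpace N => y.2 ⟨0, hN0⟩ ^ 2 - T) s z
        ∂((pinnedChain ω₂ lam β γ).gibbsMeasure N T)) + ∫ s in (0 : ℝ)..t, ∫ z, (z.2 ⟨0, hN0⟩ ^ 2 - T) *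
          evolve (pinnedChain ω₂ lam β γ) N T (fun y : PhaseSpace N => y.2 ⟨N - 1, by omega⟩ ^ 2 - T) s z ∂((pinnedChain ω₂ lam β γ).gibbsMeasure N T)) := by
    rw [← hsplit]; exact hH
  rw [hL, hX]
  linear_combination (-(γ * ((N : ℝ) - 1) / T ^ 2)) * hH'

end Summit.AtomisticToContinuum.FouriersLaw.Cruxes.ConductanceLowerBound.KickDipoleNoCollapse

end
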